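import Literature.Probability.Percolation.TriCorrLengthExponentFromFacts
import Literature.Probability.Percolation.FiveArmLowerBound
import HarnessLib

/-!
# `ξ(p) = |p - 1/2|^{-4/3 + o(1)}` from the four-arm exponent and two near-critical facts (assembly, proofs only)

Topic `Literature/Probability/Percolation`; family `crit-perc`. PROOFS ONLY (no definition, no
named fact): the current state of the discharge of the named fact
`Literature.Probability.Percolation.triCorrLength_exponent` (`ArmExponents.lean`; S. Smirnov,
W. Werner, *Critical exponents for two-dimensional percolation*, Math. Res. Lett. 8 (2001)
729–744, Thm. 1 (iii)–(iv) of the arXiv text `math/0109120`, p. 3, and the paragraph following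
Thm. 1: "It has been shown by Kesten [13] that all these results hold provided that
`P[A¹_R] = R^{-5/48+o(1)}` and `P[A²_R] = R^{-5/4+o(1)}`").

`TriCorrLengthExponentFromFacts.lean` proves `ν = 4/3` from the four-arm exponent and Kesten's
scaling relation at Nolin's characteristic length (`triCorrLength_exponent_of_prop34 :
fourArm_exponent → Nolin2008_prop34 → triCorrLength_exponent`; the Russo–Seymour–Welsh theory
below `L_ε(p)`, the exponential decay beyond it and the comparison `ξ ≍ L_ε` being theorems of
the tree), and from the four named facts of W. Werner's Lecture 6 through
`Nolin2008_prop34_of_facts` (`triCorrLength_exponent_of_facts₄`, the half-plane two-arm estimate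
`Werner2009_halfPlane_twoArm_holds` already fed in). One more of these has since become a theorem
of the tree: `Werner2009_fourArm_lowerBound_holds` (`FiveArmLowerBound.lean`: the
separation-free two-radii five-arm lower bound and Reimer's inequality). This file feeds it in:

* `triCorrLength_exponent_of_facts₃` : **`fourArm_exponent → Werner2009_fourArm_quasiMult →
  Werner2009_pivotal_lowerBound → triCorrLength_exponent`**.

What remains for `triCorrLength_exponent_holds` is exactly: the four-arm exponent `5/4`
(`fourArm_exponent`, `ArmExponents.lean`: Smirnov–Werner Thm. 4 for `j = 4`; by
`fourArm_exponent_of_separation` of `ArmSeparationFourArmProofs.lean` it rests on the `SLE₆`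
scaling limit of the four-arm probabilities, their `SLE₆` exponent, and four-arm separation at
`p = 1/2`) and the two near-critical four-arm estimates below `L(p)` resting on Kesten's
separation of arms — the quasi-multiplicativity `Werner2009_fourArm_quasiMult`
(`NearCriticalFourArmFacts.lean`; Werner 2009, Lecture 6, Cor. 6.2) and the pivotal lower bound
for interior sites `Werner2009_pivotal_lowerBound` (`NearCriticalBoundaryFacts.lean`; Werner
2009, Lecture 6, proof of Lemma 6.2; reduced to near-critical four-arm separation by
`Werner2009_pivotal_lowerBound_of_separation`, `PivotalLowerBoundFromSeparation.lean`). The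
discharge is `triCorrLength_exponent_of_facts₃ fourArm_exponent_holds
Werner2009_fourArm_quasiMult_holds Werner2009_pivotal_lowerBound_holds` once these land (none is
in the tree yet). The older assemblies `…_of_prop34`, `…_of_facts₄`
(`TriCorrLengthExponentFromFacts.lean`), `…_of_leaves₂` (`NearCriticalRSWStart.lean`, from
`Werner2009_lemma62`) and `…_of_leaves` / `…_of_seed` (`TriRSWSeed.lean`) remain available.

## References

* S. Smirnov, W. Werner, Critical exponents for two-dimensional percolation, *Math. Res. Lett.* 8
  (2001) 729–744; arXiv:math/0109120, §1 Thm. 1 (iii)–(iv) and the paragraph following Thm. 1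
  [SmirnovWernerMRL2001].
* H. Kesten, Scaling relations for 2D-percolation, *Comm. Math. Phys.* 109 (1987) 109–156,
  (4.5) and Cor. 1–2 [KestenScalingCMP1987].
* P. Nolin, Near-critical percolation in two dimensions, *Electron. J. Probab.* 13 (2008)
  1562–1623, §7.2 Thm. 33, §7.3 Prop. 34, §7.4 Lemma 39 (arXiv 0711.4948: Thm. 31, Prop. 32,
  Lemma 37) [Nolin2008].
* W. Werner, *Lectures on two-dimensional critical percolation*, IAS/Park City Math. Ser. 16
  (2009), Lecture 6, §3, Cor. 6.2, Lemma 6.2, Cor. 6.3, Lemma 6.3 [WernerPCMI2009].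

Tree: `triCorrLength_exponent_of_facts₄` (`TriCorrLengthExponentFromFacts.lean`),
`Werner2009_fourArm_lowerBound_holds` (`FiveArmLowerBound.lean`),
`Werner2009_halfPlane_twoArm_holds` (`HalfPlaneTwoArmRadiiNearCritical.lean`, through
`triCorrLength_exponent_of_facts₄`). Mathlib: nothing beyond the imports of these files.
-/

namespace Literature.Probability.Percolation

/-- **`ν = 4/3` from the four-arm exponent and the two remaining near-critical four-arm
estimates** (Smirnov–Werner 2001, Thm. 1 (iii)–(iv): `ξ(p) = |p - 1/2|^{-4/3+o(1)}` as
`p → 1/2`; Kesten's relation `|p - 1/2| L_ε(p)² π₄(L_ε(p)) ≍ 1` from Werner 2009, Lecture 6, with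
the five-arm/Reimer lower bound `Werner2009_fourArm_lowerBound_holds` and the half-plane two-arm
estimate `Werner2009_halfPlane_twoArm_holds` supplied by the tree): the quasi-multiplicativity
below `L(p)` and the pivotal lower bound for interior sites are the only near-critical inputs
left. [cite: SmirnovWernerMRL2001, Thm. 1 (iii)–(iv) and the paragraph following it] [cite: WernerPCMI2009, Lecture 6, Cor. 6.2, §3, Lemma 6.2–6.3] [cite: Nolin2008, §7.3 Prop. 34, §7.4 Lemma 39 (arXiv 0711.4948: Prop. 32, Lemma 37)] [cite: KestenScalingCMP1987, (4.5) and Cor. 1–2] -/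
theorem triCorrLength_exponent_of_facts₃ (h₄ : fourArm_exponent)
    (hQM : Werner2009_fourArm_quasiMult) (hP : Werner2009_pivotal_lowerBound) :
    triCorrLength_exponent :=
  triCorrLength_exponent_of_facts₄ h₄ hQM Werner2009_fourArm_lowerBound_holds hP

end Literature.Probability.Percolation
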